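import Mathlib
import Literature.Geometry.Lorentzian.LorentzianMetric
import Literature.Geometry.Lorentzian.Geodesic
import Literature.Geometry.Lorentzian.GeodesicUniformTime
import Literature.Geometry.Lorentzian.GeodesicExtension
import Literature.Geometry.Lorentzian.LeviCivitaProofs
import Literature.Geometry.Lorentzian.NullRayNonImprisonment

/-!
# Route PhotonSphereChannels · crux `TameCensorship` (stmt-FinalStateConjecture-17431) · line `Sketch`, skeleton v5 ·
# stub `stub_maximalGeodesic_notCompactLift`: the escape lemma for maximal geodesics of a spacetime

Helper file (`--supports stmt-FinalStateConjecture-17431`) of line `Sketch` (lead c2, 2026-08-17), a brick of the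
PANCAKE LAW (alternative route to clause (a) of K3, skeleton v5). A MAXIMAL geodesic of the Levi-Civita connection
of a spacetime whose parameter domain is bounded above cannot have its tangent lift confined, towards the end of
the domain, to a compact subset of the tangent bundle: geodesics with initial data in a compact set exist for a
uniform time `ε` (`exists_uniform_isGeodesicOn_of_isCompact`), so the geodesic could be continued past `sup dom`,
contradicting maximality. In the pancake law this (with the winding bound) makes visible incomplete null rays
future-endless, hence non-imprisoned in compact chart half-balls and eventually inside `J⁺(ιΣ)`.

References: B. O'Neill, *Semi-Riemannian Geometry* (1983), Ch. 3, Lemma 22 and p. 68; J. M. Lee, *Introduction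
to Riemannian Manifolds* (2018), Lemma 6.19, Thm. 4.27.
-/

set_option linter.dupNamespace false

open Literature.Geometry.Lorentzian
open scoped Manifold ContDiff Topology
open Set Filter Bundle

noncomputable section

namespace Summit.FinalStateConjecture.FinalStateConjecture.Theorems.PhotonSphereChannels.TameCensorshipUnwind

/-- **Stub `stub_maximalGeodesic_notCompactLift` of line `Sketch` (skeleton v5) for the crux
`PhotonSphereChannels.TameCensorship` (stmt-FinalStateConjecture-17431): THE ESCAPE LEMMA.** In a spacetime `𝓢`, let
`γ` be a maximal geodesic of the Levi-Civita connection with parameter domain `dom` bounded above, `t₀ ∈ dom`, and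
`K` a compact subset of the tangent bundle containing the tangent lifts `(γ t, γ' t)` for all `t ∈ dom`, `t ≥ t₀`.
This is absurd: with the uniform existence time `ε > 0` for geodesics with initial data in `K`
(`exists_uniform_isGeodesicOn_of_isCompact`), choose `t ∈ dom`, `t ≥ t₀`, with `sSup dom − ε/2 < t`; the geodesic
through `(γ t, γ' t)` on `(−ε, ε)`, translated to `(t − ε, t + ε)`, glues to `γ` (`IsGeodesicOn.piecewise`) into a
geodesic on the open order-connected set `dom ∪ (t − ε, t + ε)`, which strictly contains `dom` (it contains
`t + ε/2 > sSup dom`, whereas every parameter of `dom` is `≤ sSup dom`), contradicting the maximality clause of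
`IsMaximalGeodesicOn`.
[folklore; O'Neill 1983, Ch. 3, Lemma 22 and p. 68; Lee 2018, Lemma 6.19] -/
theorem stub_maximalGeodesic_notCompactLift :
    ∀ (𝓢 : Spacetime.{0} 4) [𝓢.metric.HasLeviCivita] (γ : ℝ → 𝓢.carrier) (dom : Set ℝ)
    (K : Set (Bundle.TotalSpace E4 (TangentSpace (𝓡 4) : 𝓢.carrier → Type))) (t₀ : ℝ),
    IsMaximalGeodesicOn 𝓢.metric.leviCivita γ dom → BddAbove dom → t₀ ∈ dom → IsCompact K →
    (∀ t ∈ dom, t₀ ≤ t → tangentLift (𝓡 4) γ t ∈ K) → False := by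
  intro 𝓢 _ γ dom K t₀ hmax hbdd ht₀ hK hlift
  classical
  -- the Levi-Civita connection of the `C^∞` metric is `C¹`
  haveI : CovariantDerivative.ContMDiffCovariantDerivative 𝓢.metric.leviCivita 1 :=
    ⟨𝓢.metric.isLocallyContMDiff_leviCivita_holds 1 (by exact_mod_cast le_top) univ isOpen_univ⟩
  -- uniform existence time `ε` for geodesics with initial data in `K`
  obtain ⟨ε, hε, hunif⟩ :=
    exists_uniform_isGeodesicOn_of_isCompact (cov := 𝓢.metric.leviCivita) hK
  obtain ⟨hopen, hord, hgeo, hmaxcl⟩ := hmax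
  have hne : dom.Nonempty := ⟨t₀, ht₀⟩
  -- a parameter `t ∈ dom`, `t ≥ t₀`, with `sSup dom - ε / 2 < t`
  obtain ⟨t', ht'dom, hSt'⟩ :=
    exists_lt_of_lt_csSup hne (show sSup dom - ε / 2 < sSup dom by linarith)
  set t := max t₀ t' with ht_def
  have htdom : t ∈ dom := by
    rcases le_total t₀ t' with h | h
    · rw [ht_def, max_eq_right h]
      exact ht'dom
    · rw [ht_def, max_eq_left h]
      exact ht₀
  have ht₀t : t₀ ≤ t := le_max_left _ _
  have hSt : sSup dom - ε / 2 < t := lt_of_lt_of_le hSt' (le_max_right _ _)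
  -- the geodesic through the tangent lift `(γ t, γ' t) ∈ K`, translated to `(t - ε, t + ε)`
  obtain ⟨β, hβ, hβ0⟩ := hunif _ (hlift t htdom ht₀t)
  have hβ' : IsGeodesicOn 𝓢.metric.leviCivita (fun s ↦ β (s - t)) (Ioo (t - ε) (t + ε)) := by
    refine (hβ.comp_sub_const t).mono fun s hs ↦ ?_
    simp only [mem_preimage, mem_Ioo] at hs ⊢
    constructor <;> linarith [hs.1, hs.2]
  have htUV : t ∈ dom ∩ Ioo (t - ε) (t + ε) := ⟨htdom, by constructor <;> linarith⟩
  have hlift_eq : tangentLift (𝓡 4) γ t = tangentLift (𝓡 4) (fun s ↦ β (s - t)) t := by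
    rw [tangentLift_comp_sub_const β t t, sub_self, hβ0]
  -- glue: a geodesic on `dom ∪ (t - ε, t + ε)` agreeing with `γ` on `dom`
  obtain ⟨hg, hgγ, -⟩ :=
    hgeo.piecewise hopen isOpen_Ioo (hord.inter Set.ordConnected_Ioo) hβ' htUV hlift_eq
  -- the union is an open interval
  have hordU : (dom ∪ Ioo (t - ε) (t + ε)).OrdConnected :=
    isPreconnected_iff_ordConnected.1
      (IsPreconnected.union t htdom htUV.2 (isPreconnected_iff_ordConnected.2 hord)
        isPreconnected_Ioo)
  -- maximality: the union is `dom` ...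
  have hEq : dom ∪ Ioo (t - ε) (t + ε) = dom :=
    hmaxcl _ _ (hopen.union isOpen_Ioo) hordU subset_union_left hg hgγ.symm
  -- ... but it contains `t + ε / 2 > sSup dom`
  have hmem : t + ε / 2 ∈ dom ∪ Ioo (t - ε) (t + ε) := Or.inr ⟨by linarith, by linarith⟩
  rw [hEq] at hmem
  have h := le_csSup hbdd hmem
  linarith

end Summit.FinalStateConjecture.FinalStateConjecture.Theorems.PhotonSphereChannels.TameCensorshipUnwind

end
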